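import Summits.QuantumFields.QCD.Theorems.NestedDissectionSeaNegativeCellsDiluteStubSignMobility
import Summits.QuantumFields.QCD.Theorems.NestedDissectionSeaNegativeCellsDiluteStubConcentration
import Summits.QuantumFields.QCD.Theorems.NestedDissectionSeaNegativeCellsDiluteStubPinOfFloor
import Literature.MathematicalPhysics.QuantumFieldTheory.QCDPhaseQuenched

/-!
# `NegativeCellsDilute` from windowed dilution + block floor + ratio mixing — the WEAKEST certified transfer of line
# `mass-wegner-cell-index` (sign-mobility graft), for the planners' promotion choice
(crux `Summit.QuantumFields.QCD.Theses.NestedDissectionSea.NegativeCellsDilute`, item stmt-QuantumFields-13900,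
route route-QuantumFields-NestedDissectionSea; continuation lead prover-line-stmt-QuantumFields-13900-1, 2026-08-16)

The companion files certify `(a⁺) ∧ (b) ⇒ crux` (`…OfPinnedStripLaw`, p95347) and `(a⁺) ∧ floor ∧ mixing ⇒ crux`
(`…OfTunedStripWitness`, p95409), where (a⁺) is the line's WINDOWED STRIP LAW — an `η`-fattened, `κ`-weighted
strengthening of the crux's dilution clause (a) (reverse Wegner). This file records the third corner of the square:
the crux already follows from its OWN clause (a), verbatim, together with the block floor and the ratio mixing under the
same regularisation — the transfer of the crux idea `sign-mobility-identity` (its open stub `stub_tunedWitness`), which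
is WEAKER than the tuned strip witness (it does not commit to the strip statistic) and therefore the safer statement to
promote if the planners keep the pin discharged into floor ∧ mixing. Proof: `stub_pinOfFloor` (fed `stub_signMobility`,
`stub_concentration`) turns floor ∧ mixing into the pin (b) on all odd tori of physical side `≥ R₀`; clause (a) is
monotone in the size threshold, so `max R R₀` serves both. Pure theorem file, no definitions, standard axioms; the
hypothesis is open physics and is NOT asserted here.
-/

noncomputable section

namespace Summit.QuantumFields.QCD.Cruxes.NegativeCellsDilute.MassWegnerCellIndex

open scoped BigOperators ENNReal Classical
open MeasureTheory Filter
open Literature.MathematicalPhysics.QuantumLattice Literature.MathematicalPhysics.QuantumFieldTheory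
  Literature.Probability.LatticeModels
open Summit.QuantumFields.QCD.Theses.NestedDissectionSea (NegativeCellsDilute)

/-- **Dilution ∧ floor ∧ mixing imply the crux.** `NegativeCellsDilute` follows from ONE admissible regularisation
carrying, for every mass tuple above the threshold and from some physical size `R` on, (a) the crux's WINDOWED LOCAL
DILUTION clause verbatim, and, for block data `L_b, d₀ > 0`, a floor `p₀ > 0` and `0 ≤ θ ≤ 1/8`, the BLOCK FLOOR
(`⟨m_b⟩₊ ≥ p₀` for the heat-bath flip propensity of every link block of side `⌈L_b/a_k⌉` at probe
`mcrit k − a_k M/Z_m k`) and the RATIO MIXING (relative covariance `≤ θ` for `⌈d₀/a_k⌉`-apart blocks), for every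
`M > M₀`, eventually in `k`, on every odd torus of physical side `≥ R`. The pin (b) is `stub_pinOfFloor` applied to
`stub_signMobility` and `stub_concentration`; answer with `max R R₀`. -/
theorem negativeCellsDilute_of_diluteFloorMixing
    (h : ∀ Nf : ℕ, (Nf = 2 ∨ Nf = 3) → ∃ reg : QCDRegularisation Nf, reg.HasMassScaling ∧
        (reg.scheme 0 0 0).HasAsymptoticScaling ∧ ∃ M₀ : ℝ, 0 ≤ M₀ ∧ ∃ b₀ : ℕ, 2 ≤ b₀ ∧ ∃ ℓ : ℝ, 0 < ℓ ∧
        ∀ m : Fin Nf → ℝ, (∀ f, M₀ < m f) → ∃ R : ℝ, 0 < R ∧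
        ∃ Lb d₀ p₀ θ : ℝ, 0 < Lb ∧ 0 < d₀ ∧ 0 < p₀ ∧ 0 ≤ θ ∧ θ ≤ 1 / 8 ∧
        (∀ ε : ℝ, 0 < ε → ∀ᶠ k : ℕ in Filter.atTop, ∀ S : ℕ, R ≤ reg.a k * (2 * S + 1) →
          let N : ℕ := 2 * S + 1
          let mq : Fin Nf → ℝ := fun f => reg.mcrit k + reg.a k * m f / reg.Zm k
          let wt : GaugeConfig 4 N (Matrix.specialUnitaryGroup (Fin 3) ℂ) → ℝ := fun U =>
            ∏ f, ‖fermionDet (wilsonDirac (fundamentalRep (Fin 3)) U (mq f) 1)‖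
          let P : (GaugeConfig 4 N (Matrix.specialUnitaryGroup (Fin 3) ℂ) → Prop) → ℝ := fun E =>
            (∫ U, (if E U then (1 : ℝ) else 0) * wt U
                ∂(wilsonMeasure (d := 4) (L := N) (fundamentalRep (Fin 3)) (reg.β k))) /
              (∫ U, wt U ∂(wilsonMeasure (d := 4) (L := N) (fundamentalRep (Fin 3)) (reg.β k)))
          let J : ℕ := Nat.log 2 (⌊ℓ / reg.a k⌋₊ / b₀) + 1
          ∃ δ : ℕ → ℝ, ∑ j ∈ Finset.range J, δ j ≤ ε ∧ ∀ j < J, ∀ s : Fin 4 → ℕ,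
            (∀ i, b₀ * 2 ^ j ≤ s i ∧ s i < b₀ * 2 ^ (j + 2) ∧ s i ≤ N ∧ (s i : ℝ) * reg.a k ≤ ℓ) →
            P (fun U => ∃ f, IsSignDefect U (mq f) j s) ≤ δ j) ∧
        (∀ M : ℝ, M₀ < M → ∀ᶠ k : ℕ in Filter.atTop, ∀ S : ℕ, R ≤ reg.a k * (2 * S + 1) →
          let N : ℕ := 2 * S + 1
          let mq : Fin Nf → ℝ := fun f => reg.mcrit k + reg.a k * m f / reg.Zm k
          let μp : ℝ := reg.mcrit k - reg.a k * M / reg.Zm k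
          let n : ℕ := ⌈Lb / reg.a k⌉₊
          let g : ℕ := ⌈d₀ / reg.a k⌉₊
          let σ : GaugeConfig 4 N SU3 → ℝ := fun U =>
            if (fermionDet (wilsonDirac (fundamentalRep (Fin 3)) U μp 1)).re < 0 then -1 else 1
          let w : GaugeConfig 4 N SU3 → ℝ := fun U =>
            Real.exp (-(reg.β k * wilsonAction (fundamentalRep (Fin 3)) U)) *
              ∏ f, ‖fermionDet (wilsonDirac (fundamentalRep (Fin 3)) U (mq f) 1)‖
          let blk : TorusSite 4 N → Finset (Edge 4 N) := fun x =>
            Finset.univ.filter fun e => ∀ i, (e.1 i - x i).val < n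
          let r : Finset (Edge 4 N) → GaugeConfig 4 N SU3 → GaugeConfig 4 N SU3 → GaugeConfig 4 N SU3 :=
            fun B U V e => if e ∈ B then V e else U e
          let mb : TorusSite 4 N → GaugeConfig 4 N SU3 → ℝ := fun x U =>
            (∫ V, (if σ (r (blk x) U V) ≠ σ U then (1 : ℝ) else 0) * w (r (blk x) U V)
                ∂(Measure.pi fun _ : Edge 4 N => haarProbability SU3)) /
              (∫ V, w (r (blk x) U V) ∂(Measure.pi fun _ : Edge 4 N => haarProbability SU3))
          (∀ x : TorusSite 4 N, p₀ ≤ qcdPhaseQuenchedExpect (reg.β k) N mq (mb x)) ∧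
          (∀ x x' : TorusSite 4 N,
            (∃ i : Fin 4, ∀ t t' : ℕ, t < n → t' < n →
              g ≤ ((x i + (t : ZMod N)) - (x' i + (t' : ZMod N))).val ∧
                g ≤ ((x' i + (t' : ZMod N)) - (x i + (t : ZMod N))).val) →
            qcdPhaseQuenchedExpect (reg.β k) N mq (fun U => mb x U * mb x' U) -
                qcdPhaseQuenchedExpect (reg.β k) N mq (mb x) * qcdPhaseQuenchedExpect (reg.β k) N mq (mb x') ≤
              θ * (qcdPhaseQuenchedExpect (reg.β k) N mq (mb x) *
                qcdPhaseQuenchedExpect (reg.β k) N mq (mb x'))))) :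
    NegativeCellsDilute := by
  have h₁ := stub_signMobility
  have h₂ := stub_concentration
  have h₃ := stub_pinOfFloor
  intro Nf hNf
  obtain ⟨reg, hms, has, M₀, hM₀, b₀, hb₀, ℓ, hℓ, hm⟩ := h Nf hNf
  refine ⟨reg, hms, has, M₀, hM₀, b₀, hb₀, ℓ, hℓ, fun m hmM => ?_⟩
  obtain ⟨R, hR, Lb, d₀, p₀, θ, hLb, hd₀, hp₀, hθ, hθ8, hA, hFM⟩ := hm m hmM
  obtain ⟨R₀, hR₀, hpin⟩ := h₃ h₁ h₂ Nf reg M₀ m Lb d₀ p₀ θ R hLb hd₀ hp₀ hθ hθ8 hFM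
  refine ⟨max R R₀, lt_max_of_lt_left hR, fun ε hε => ?_, hpin (max R R₀) (le_max_right R R₀)⟩
  filter_upwards [hA ε hε] with k hk
  intro S hS
  exact hk S ((le_max_left R R₀).trans hS)

end Summit.QuantumFields.QCD.Cruxes.NegativeCellsDilute.MassWegnerCellIndex

end
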